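import Summits.CriticalPhenomena.CardyFormulaZ2.Theorems.CardyUniqueLimitCardyRigidityDefs

/-!
# Asymptotics of the scale and admissibility of the tight data (line `crossing-martingale`, crux `CardyRigidity`)

Elementary layer of the far-field MOMENT engine (stubs `stub_betaPinning` / `stub_kernelAffineBeta`,
crux `CardyRigidity`, stmt-CriticalPhenomena-0746).  Marks `xₙ = n·(a,b,c)` (`0 < a < b < c`),
TIGHT levels `mₙ = na - n^{3/4}`, `Mₙ = na + n^{3/4}` for the first mark and
`dₙ = n·min(b-a, c-b) - n^{3/4}` for the gaps:

* `eventually_rpow_le_mul`, `eventually_le_rpow` — `n^{3/4}/n → 0` and `n^{3/4} → ∞` along `ℕ`;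
* `admissibleLevels_scale` — the tight data are admissible once `n^{3/4} < n·min(a, b-a, c-b)`;
* `eventually_scale` — the finitely many eventual inequalities between `n`, `n^{3/4}` and
  `(a, b, c, t)` that the pathwise expansion (`…FarFieldPathwise`) consumes.
-/

noncomputable section

open MeasureTheory Filter Set Topology
open scoped NNReal ENNReal
open Literature.Probability.RandomPlanarGeometry

namespace Summit.CriticalPhenomena.CardyFormulaZ2.Cruxes.CardyRigidity.CrossingMartingale

namespace FarField

/-! ### Asymptotics of the scale -/

/-- `n^{3/4} = n · n^{-1/4}` for `n > 0`. [folklore] -/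
theorem rpow_three_quarters_eq {n : ℝ} (hn : 0 < n) :
    n ^ (3 / 4 : ℝ) = n * n ^ (-(1 / 4 : ℝ)) := by
  rw [show (3 / 4 : ℝ) = 1 + -(1 / 4 : ℝ) by norm_num, Real.rpow_add hn, Real.rpow_one]

/-- `n^{3/4}/n → 0` along the naturals, in the form `∀ ε > 0, eventually n^{3/4} ≤ ε n`.
[folklore] -/
theorem eventually_rpow_le_mul {ε : ℝ} (hε : 0 < ε) :
    ∀ᶠ n : ℕ in atTop, ((n : ℝ)) ^ (3 / 4 : ℝ) ≤ ε * n := by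
  have h1 : Tendsto (fun n : ℕ ↦ ((n : ℝ)) ^ (-(1 / 4 : ℝ))) atTop (𝓝 0) :=
    (tendsto_rpow_neg_atTop (by norm_num : (0 : ℝ) < 1 / 4)).comp tendsto_natCast_atTop_atTop
  have h2 := h1.eventually (Iic_mem_nhds hε)
  filter_upwards [h2, eventually_gt_atTop 0] with n hn hn0
  have hnpos : (0 : ℝ) < n := by exact_mod_cast hn0
  rw [rpow_three_quarters_eq hnpos, mul_comm]
  exact mul_le_mul_of_nonneg_right hn hnpos.le

/-- `n^{3/4} → ∞` along the naturals. [folklore] -/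
theorem eventually_le_rpow (C : ℝ) : ∀ᶠ n : ℕ in atTop, C ≤ ((n : ℝ)) ^ (3 / 4 : ℝ) :=
  ((tendsto_rpow_atTop (by norm_num : (0 : ℝ) < 3 / 4)).comp
    tendsto_natCast_atTop_atTop).eventually_ge_atTop C

variable {a b c : ℝ}

/-- **Admissibility of the tight data at large scale**: marks `n·(a,b,c)`, levels
`na ∓ n^{3/4}` for the first mark and `n·min(b-a,c-b) - n^{3/4}` for the gaps. [folklore] -/
theorem admissibleLevels_scale (ha : 0 < a) (hab : a < b) (hbc : b < c) {n : ℕ} (hn : 0 < n)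
    (hq : ((n : ℝ)) ^ (3 / 4 : ℝ) < n * min a (min (b - a) (c - b))) :
    AdmissibleLevels (fun i ↦ (n : ℝ) * ![a, b, c] i)
      (n * a - (n : ℝ) ^ (3 / 4 : ℝ)) (n * a + (n : ℝ) ^ (3 / 4 : ℝ))
      (n * min (b - a) (c - b) - (n : ℝ) ^ (3 / 4 : ℝ)) := by
  have hnpos : (0 : ℝ) < n := by exact_mod_cast hn
  have hqpos : 0 < ((n : ℝ)) ^ (3 / 4 : ℝ) := Real.rpow_pos_of_pos hnpos _
  have hmin_a : min a (min (b - a) (c - b)) ≤ a := min_le_left _ _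
  have hmin_g : min a (min (b - a) (c - b)) ≤ min (b - a) (c - b) := min_le_right _ _
  have hg1 : min (b - a) (c - b) ≤ b - a := min_le_left _ _
  have hg2 : min (b - a) (c - b) ≤ c - b := min_le_right _ _
  have hqa : ((n : ℝ)) ^ (3 / 4 : ℝ) < n * a := hq.trans_le (by gcongr)
  have hqg : ((n : ℝ)) ^ (3 / 4 : ℝ) < n * min (b - a) (c - b) := hq.trans_le (by gcongr)
  refine ⟨?_, ?_, ?_, ?_, ?_, ?_, ?_, ?_⟩
  · intro i j hij
    simp only
    have : ![a, b, c] i < ![a, b, c] j := by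
      fin_cases i <;> fin_cases j <;> simp at hij ⊢ <;> linarith
    exact mul_lt_mul_of_pos_left this hnpos
  · simp only [Matrix.cons_val_zero]; positivity
  · linarith
  · simp only [Matrix.cons_val_zero]; linarith
  · simp only [Matrix.cons_val_zero]; linarith
  · linarith
  · simp only [Matrix.cons_val_one, Matrix.cons_val_zero]
    have : (n : ℝ) * min (b - a) (c - b) ≤ n * (b - a) := by gcongr
    nlinarith
  · simp only [Matrix.cons_val_one, Matrix.cons_val]
    have : (n : ℝ) * min (b - a) (c - b) ≤ n * (c - b) := by gcongr
    nlinarith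

/-- **The scale is eventually large**: the finitely many inequalities between `n`, `n^{3/4}`
and the fixed data `(a, b, c, t)` that the pathwise expansion uses. [folklore] -/
theorem eventually_scale (ha : 0 < a) (hab : a < b) (hbc : b < c) (t : ℝ) (ht : 0 ≤ t) :
    ∀ᶠ n : ℕ in atTop, 0 < n ∧
      ((n : ℝ)) ^ (3 / 4 : ℝ) < n * min a (min (b - a) (c - b)) ∧
      ((n : ℝ)) ^ (3 / 4 : ℝ) ≤ n * a / 2 ∧
      4 * t / (n * a) < min 1 (((n : ℝ)) ^ (3 / 4 : ℝ) / 2) ∧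
      (((n : ℝ)) ^ (3 / 4 : ℝ) + 1) / n ≤ min (min a (b - a)) (c - b) / 4 ∧
      2 * t / ((n : ℝ) ^ 2 * a) + ((n : ℝ)) ^ (3 / 4 : ℝ) / (2 * n) +
        4 * t * (((n : ℝ)) ^ (3 / 4 : ℝ) / 2 + 1) / (a ^ 2 * (n : ℝ) ^ 3) ≤
          min (min a (b - a)) (c - b) / 4 := by
  set g : ℝ := min a (min (b - a) (c - b)) with hg
  set ρ₀ : ℝ := min (min a (b - a)) (c - b) / 4 with hρ₀
  have hgpos : 0 < g := lt_min ha (lt_min (by linarith) (by linarith))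
  have hρ₀pos : 0 < ρ₀ := by
    have : 0 < min (min a (b - a)) (c - b) := lt_min (lt_min ha (by linarith)) (by linarith)
    positivity
  -- `q ≤ ε n` for the three small `ε` we need, `q ≥ C`, and `n ≥ C'`
  have e1 := eventually_rpow_le_mul (half_pos hgpos)        -- q ≤ (g/2) n
  have e2 := eventually_rpow_le_mul (half_pos ha)           -- q ≤ (a/2) n
  have e3 := eventually_rpow_le_mul (by positivity : (0 : ℝ) < ρ₀ / 4)  -- q ≤ (ρ₀/4) n
  have e4 := eventually_le_rpow (16 * t / a + 2)            -- q large
  have e5 : ∀ᶠ n : ℕ in atTop,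
      ((4 * t + 1) / a + 4 / ρ₀ + 16 * t / (a ^ 2 * ρ₀) + 8 * t / (a * ρ₀) + 2 : ℝ) ≤ n :=
    tendsto_natCast_atTop_atTop.eventually_ge_atTop _
  filter_upwards [e1, e2, e3, e4, e5, eventually_gt_atTop 0] with n h1 h2 h3 h4 h5 hn0
  have hnpos : (0 : ℝ) < n := by exact_mod_cast hn0
  have hn1 : (1 : ℝ) ≤ n := by exact_mod_cast hn0
  set q : ℝ := ((n : ℝ)) ^ (3 / 4 : ℝ) with hq
  have hqpos : 0 < q := Real.rpow_pos_of_pos hnpos _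
  have hqn : q ≤ n := by
    have : q ≤ (n : ℝ) ^ (1 : ℝ) :=
      Real.rpow_le_rpow_of_exponent_le hn1 (by norm_num)
    simpa using this
  -- from `e5`: the reciprocal bounds
  have hA0 : 0 ≤ (4 * t + 1) / a := by positivity
  have hB0 : 0 ≤ 4 / ρ₀ := by positivity
  have hC0 : 0 ≤ 16 * t / (a ^ 2 * ρ₀) := by positivity
  have hD0 : 0 ≤ 8 * t / (a * ρ₀) := by positivity
  have hn_A : (4 * t + 1) / a ≤ n := by linarith
  have hn_B : 4 / ρ₀ ≤ n := by linarith
  have hn_C : 16 * t / (a ^ 2 * ρ₀) ≤ n := by linarith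
  have hn_D : 8 * t / (a * ρ₀) ≤ n := by linarith
  have hn2 : (2 : ℝ) ≤ n := by linarith
  have hnA : 4 * t + 1 ≤ n * a := by
    have := mul_le_mul_of_nonneg_right hn_A ha.le
    rwa [div_mul_cancel₀ _ ha.ne'] at this
  have hnB : 4 ≤ n * ρ₀ := by
    have := mul_le_mul_of_nonneg_right hn_B hρ₀pos.le
    rwa [div_mul_cancel₀ _ hρ₀pos.ne'] at this
  have hnC : 16 * t ≤ n * (a ^ 2 * ρ₀) := by
    have := mul_le_mul_of_nonneg_right hn_C (by positivity : (0 : ℝ) ≤ a ^ 2 * ρ₀)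
    rwa [div_mul_cancel₀ _ (by positivity)] at this
  have hnD : 8 * t ≤ n * (a * ρ₀) := by
    have := mul_le_mul_of_nonneg_right hn_D (by positivity : (0 : ℝ) ≤ a * ρ₀)
    rwa [div_mul_cancel₀ _ (by positivity)] at this
  refine ⟨hn0, ?_, ?_, ?_, ?_, ?_⟩
  · -- q < n g
    have : g / 2 * n < n * g := by nlinarith
    exact h1.trans_lt this
  · linarith
  · -- 4t/(na) < min 1 (q/2)
    have hlt1 : 4 * t / (n * a) < 1 := by
      rw [div_lt_one (by positivity)]
      linarith
    have hlt2 : 4 * t / (n * a) < q / 2 := by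
      have hle : 4 * t / (n * a) ≤ 4 * t / a :=
        div_le_div_of_nonneg_left (by positivity) ha (by nlinarith)
      have h16 : 16 * t / a = 4 * (4 * t / a) := by ring
      have h4' : 0 ≤ 4 * t / a := by positivity
      linarith
    exact lt_min hlt1 hlt2
  · -- (q+1)/n ≤ ρ₀
    rw [div_le_iff₀ hnpos]
    linarith
  · -- the sum of the three small terms is ≤ 3ρ₀/4 ≤ ρ₀
    have hnn2 : (n : ℝ) ≤ (n : ℝ) ^ 2 := le_self_pow₀ hn1 (by norm_num)
    have hnn3 : (n : ℝ) ^ 2 ≤ (n : ℝ) ^ 3 := pow_le_pow_right₀ hn1 (by norm_num)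
    have t1 : 2 * t / ((n : ℝ) ^ 2 * a) ≤ ρ₀ / 4 := by
      rw [div_le_iff₀ (by positivity)]
      calc 2 * t ≤ n * (a * ρ₀) / 4 := by linarith [hnD]
        _ ≤ (n : ℝ) ^ 2 * (a * ρ₀) / 4 := by gcongr
        _ = ρ₀ / 4 * ((n : ℝ) ^ 2 * a) := by ring
    have t2 : q / (2 * n) ≤ ρ₀ / 4 := by
      rw [div_le_iff₀ (by positivity)]
      linarith
    have t3 : 4 * t * (q / 2 + 1) / (a ^ 2 * (n : ℝ) ^ 3) ≤ ρ₀ / 4 := by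
      rw [div_le_iff₀ (by positivity)]
      have hq1 : q / 2 + 1 ≤ n := by linarith
      calc 4 * t * (q / 2 + 1) ≤ 4 * t * n := by gcongr
        _ ≤ n * (a ^ 2 * ρ₀) / 4 * n :=
            mul_le_mul_of_nonneg_right (by linarith [hnC]) hnpos.le
        _ = ρ₀ / 4 * (a ^ 2 * (n : ℝ) ^ 2) := by ring
        _ ≤ ρ₀ / 4 * (a ^ 2 * (n : ℝ) ^ 3) := by gcongr
    linarith

/-- **Registered form** (glue sub-goal `farField_admissibleLevels_scale` of stmt-CriticalPhenomena-0746):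
the tight data at scale `n` are admissible. [folklore] -/
theorem farField_admissibleLevels_scale : ∀ {a b c : ℝ}, 0 < a → a < b → b < c → ∀ {n : ℕ}, 0 < n → ((n : ℝ)) ^ (3 / 4 : ℝ) < n * min a (min (b - a) (c - b)) → AdmissibleLevels (fun i ↦ (n : ℝ) * ![a, b, c] i) (n * a - (n : ℝ) ^ (3 / 4 : ℝ)) (n * a + (n : ℝ) ^ (3 / 4 : ℝ)) (n * min (b - a) (c - b) - (n : ℝ) ^ (3 / 4 : ℝ)) :=
  fun ha hab hbc _ hn hq ↦ admissibleLevels_scale ha hab hbc hn hq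

end FarField

end Summit.CriticalPhenomena.CardyFormulaZ2.Cruxes.CardyRigidity.CrossingMartingale

end
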